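import Literature.AlgebraicGeometry.Frobenioids.ArchimedeanPerfectionUnitTransportIndex
import Literature.AlgebraicGeometry.Frobenioids.ArchimedeanPerfectionUnitTransportTwist
import HarnessLib

/-!
# Frobenioids II, Thm. 3.6 (i)/(v) at `Λ = ℚ`: the index exponents of `(T-unit)` are NECESSARY — no Galois-twist
# bookkeeping rescues the un-indexed unit-transport law (second reading of `ArchimedeanPerfectionUnitTransportTwist`)

Mochizuki, *The geometry of Frobenioids II: poly-Frobenioids*, Kyushu J. Math. **62** (2008) 401–460, §3,
Thm. 3.6 (i) p. 36, Thm. 3.6 (v) p. 37 [cite: MochizukiFrdII2008, Thm 3.6 (v) p.37]; [FrdI] Prop. 1.11 (iv) p. 36,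
Prop. 4.4 (iv) p. 83 [cite: MochizukiFrdI2008, Prop. 1.11(iv) p.36].

abc-iut cell, layer L1, row M13-c3 (seat abc-iut-w5-d194, R132 (1) second reading of abc-iut-w5-d246's `(T-unit)` file
`ArchimedeanPerfectionUnitTransportTwist.lean`, `Thm36Sub.intertwines_unitsPerfEquiv_pow_pull`).  PROOF-ONLY.
* `not_unitTransportLaw_twisted_of_isComplex` — for EVERY choice of Galois-twist bookkeeping `σ_X, σ_{X′} : Bool` of the
  unit scalars (in particular for the structure-isomorphism twists `twistUnit (twists ι_X)` of the `(T-unit)` of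
  record), the exponent-free law "`ι(unitsPerfEquiv X [σ_X ψ^* w′]) ~_ψ ι(unitsPerfEquiv X′ [σ_{X′} w′])` for all linear
  `ψ`, all `w′`" is FALSE over any `C` with a complex object: `level_eq_of_intertwines_unitsPerfEquiv`
  (`ArchimedeanPerfectionUnitTransportIndex.lean`) is parametric in the twist.  So in `intertwines_unitsPerfEquiv_pow_pull`
  the exponents `X.idx`, `X′.idx` carry content and the twists alone do not.
* `intertwines_unitsPerfEquiv_pow_pull_frobInv` — the indexed law of record instantiated BY NAME at the very test
  arrow `[(frob₁)⁻¹] : (A′^{(b)}, n′·b) ⥲ (A′, n′)` where the exponent-free law fails (non-vacuity witness).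
Nothing here bears on [IUTchIII] Cor. 3.12.
-/

noncomputable section

namespace Literature.AlgebraicGeometry.Frobenioids

open CategoryTheory Opposite

universe v u

namespace ArchFrd

namespace Thm36Sub

variable {D : Type u} [Category.{v} D] {π : D ⥤ D0}

open PreFrobenioid PreFrobenioid.Perfection

variable (hF : PreFrobenioid.IsFrobenioid (C.toElem π))

/-- **No twist bookkeeping rescues the exponent-free unit-transport law.**  For any Boolean twists `σ τ` read on
the unit scalars of the source and target (`D0.twistUnit`), the law "for all linear `ψ : X → X′` of `C^pf` and all
`w′`, `ι(unitsPerfEquiv X [twistUnit σ (ψ^* w′)])` and `ι(unitsPerfEquiv X′ [twistUnit τ w′])` are intertwined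
along `ψ`" fails as soon as `C` has a complex object (test arrow `[(frob₁)⁻¹]`, `w′ = e^{i}`; the levels are forced
equal by `level_eq_of_intertwines_unitsPerfEquiv`). [cite: MochizukiFrdII2008, Thm 3.6 (v) p.37] -/
theorem not_unitTransportLaw_twisted_of_isComplex (A' : C π) (hA' : (π.obj A'.snd).IsComplex)
    (σ τ : pfCat π hF → Bool) :
    ¬ ∀ ⦃X X' : pfCat π hF⦄ (ψ : X ⟶ X'), IsLinear (pfStr π hF) ψ →
      ∀ w : D0.unitScalars (π.obj X'.obj.snd),
        BiratUnits.Intertwines (pf_isFrobenioid π hF) ψ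
          (BiratUnits.unitsToBirat (pf_isFrobenioid π hF) X
            (unitsPerfEquiv X (Frobenioids.Perfection.of _
              (D0.twistUnit (σ X) (π.obj X.obj.snd) (D0.unitPull (π.map (Base (pfStr π hF) ψ)) w)))))
          (BiratUnits.unitsToBirat (pf_isFrobenioid π hF) X'
            (unitsPerfEquiv X' (Frobenioids.Perfection.of _ (D0.twistUnit (τ X') (π.obj X'.obj.snd) w)))) := by
  intro hlaw
  -- the target `X′ = (A′, 1)`, an isotropic level `b = 2 n₀ ≠ 1`, the source `X = (A′^{(b)}, b)`, `ψ₀ = (frob₁)⁻¹`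
  let X' : pfCat π hF := ⟨A', 1⟩
  obtain ⟨n₀, hn₀⟩ := exists_isotropic_levels X'
  have hc' : (frobPow hF X'.obj (n₀ * 2)).fst.IsNaivelyIsotropic := hn₀ _ (dvd_mul_right n₀ 2)
  let X : pfCat π hF := ⟨frobPow hF X'.obj (n₀ * 2), X'.idx * (n₀ * 2)⟩
  have e : X.idx * 1 = X'.idx * (n₀ * 2) := mul_one _
  haveI : IsIso (frob hF X.obj 1) :=
    isIso_of_isFrobeniusType_of_degFr_eq_one hF (isFrobeniusType_frob hF X.obj 1) (degFr_frob hF X.obj 1)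
  let ψ₀ : frobPow hF X.obj 1 ⟶ frobPow hF X'.obj (n₀ * 2) := inv (frob hF X.obj 1)
  have hψ₀ : C0.degFr ψ₀.fst = 1 := ArchFrd.degFr_eq_one_of_isIso π ψ₀
  have hc : (frobPow hF X.obj 1).fst.IsNaivelyIsotropic :=
    C0.isNaivelyIsotropic_of_hom (frob hF X.obj 1).fst hc'
  have hXc : (π.obj X.obj.snd).IsComplex := isComplex_frobPow X' hA' (n₀ * 2)
  have hcx : (frobPow hF X.obj 1).fst.IsComplexObj := isComplexObj_frobPow X hXc 1
  have hcx' : (frobPow hF X'.obj (n₀ * 2)).fst.IsComplexObj := isComplexObj_frobPow X' hA' (n₀ * 2)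
  let ψ : X ⟶ X' := Hom.mk ⟨⟨1, n₀ * 2, e⟩, ψ₀⟩
  have hψ : IsLinear (pfStr π hF) ψ := PreFrobenioid.isLinear_of_isIso (C.toElem π) ψ₀
  -- a unit scalar `w₀ = e^{i}` of infinite order; test the law on `w′ := τ⁻¹ w₀ = τ w₀`
  obtain ⟨w₀, hw₀⟩ := exists_unitScalar_forall_pow_ne_one (π.obj X'.obj.snd) hA'
  have H := hlaw ψ hψ (D0.twistUnit (τ X') (π.obj X'.obj.snd) w₀)
  have hτ : D0.twistUnit (τ X') (π.obj X'.obj.snd) (D0.twistUnit (τ X') (π.obj X'.obj.snd) w₀) = w₀ :=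
    Subtype.ext (by rw [D0.coe_twistUnit, D0.coe_twistUnit, D0.galAct_galAct])
  rw [hτ] at H
  have hab := level_eq_of_intertwines_unitsPerfEquiv X X' (pf_isFrobenioid π hF) e hc hc' ψ₀ hψ₀ hcx hcx' _ w₀
    (xor (τ X') (xor (D0.Hom.twists (π.map (Base (pfStr π hF) ψ))) (σ X)))
    (by rw [D0.coe_twistUnit, D0.coe_unitPull, D0.coe_twistUnit, D0.galAct_xor, D0.galAct_xor]) hw₀ H
  have h1 := congrArg PNat.val hab
  simp only [PNat.mul_coe, PNat.val_ofNat] at h1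
  omega

/-- **Non-vacuity of the indexed `(T-unit)` at the test arrow**: abc-iut-w5-d246's `intertwines_unitsPerfEquiv_pow_pull`
instantiated BY NAME at `ψ = [(frob₁)⁻¹] : (A^{(b)}, n·b) ⥲ (A, n)` — the arrow along which the exponent-free law
fails — for every unit scalar `w′` (the instance `IsIso (frob₁)` is `Thm36Sub.isIso_frob_one`, file `Thm36SubIxQ`).
[cite: MochizukiFrdII2008, Thm 3.6 (v) p.37] -/
theorem intertwines_unitsPerfEquiv_pow_pull_frobInv (Y : pfCat π hF) (b : ℕ+)
    [IsIso (frob hF (frobPow hF Y.obj b) 1)] (w' : D0.unitScalars (π.obj Y.obj.snd)) :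
    BiratUnits.Intertwines (pf_isFrobenioid π hF)
      (Hom.mk (⟨⟨1, b, mul_one _⟩, inv (frob hF (frobPow hF Y.obj b) 1)⟩ :
        Rep (⟨frobPow hF Y.obj b, Y.idx * b⟩ : pfCat π hF) Y))
      (BiratUnits.unitsToBirat (pf_isFrobenioid π hF) (⟨frobPow hF Y.obj b, Y.idx * b⟩ : pfCat π hF)
        ((unitsPerfEquiv (⟨frobPow hF Y.obj b, Y.idx * b⟩ : pfCat π hF)
          (Frobenioids.Perfection.of _
            (D0.twistUnit (D0.Hom.twists (frobPow hF Y.obj b).iso.hom) _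
              (D0.unitPull (π.map (Base (pfStr π hF)
                (Hom.mk (⟨⟨1, b, mul_one _⟩, inv (frob hF (frobPow hF Y.obj b) 1)⟩ :
                  Rep (⟨frobPow hF Y.obj b, Y.idx * b⟩ : pfCat π hF) Y)))) w')))) ^ ((Y.idx * b : ℕ+) : ℕ)))
      (BiratUnits.unitsToBirat (pf_isFrobenioid π hF) Y
        ((unitsPerfEquiv Y (Frobenioids.Perfection.of _
          (D0.twistUnit (D0.Hom.twists Y.obj.iso.hom) _ w'))) ^ (Y.idx : ℕ))) :=
  intertwines_unitsPerfEquiv_pow_pull (pf_isFrobenioid π hF)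
    (Hom.mk (⟨⟨1, b, mul_one _⟩, inv (frob hF (frobPow hF Y.obj b) 1)⟩ :
      Rep (⟨frobPow hF Y.obj b, Y.idx * b⟩ : pfCat π hF) Y))
    (show IsLinear (pfStr π hF) (Hom.mk (⟨⟨1, b, mul_one _⟩, inv (frob hF (frobPow hF Y.obj b) 1)⟩ :
        Rep (⟨frobPow hF Y.obj b, Y.idx * b⟩ : pfCat π hF) Y)) from
      PreFrobenioid.isLinear_of_isIso (C.toElem π) (inv (frob hF (frobPow hF Y.obj b) 1))) w'

/-! ### The only models of the exponent-free law: bases without complex objects -/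

/-- **Over an all-real `C` the exponent-free unit-transport law holds** (vacuously in content): every unit scalar
of a real base is `±1` (`O_ℝ^× = {±1}`), so its class in `(O_K^×)^pf` is trivial and both units are `1`
(Thm. 3.6 (v)(b): "`Λ = ℚ` and `A` real ⇒ `O^×(A)` trivial"). [cite: MochizukiFrdII2008, Thm 3.6 (v) p.37] -/
theorem unitTransportLaw_of_forall_isReal (hreal : ∀ A : C π, (π.obj A.snd).IsReal) :
    ∀ ⦃X X' : pfCat π hF⦄ (ψ : X ⟶ X'), IsLinear (pfStr π hF) ψ →
      ∀ w : D0.unitScalars (π.obj X'.obj.snd),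
        BiratUnits.Intertwines (pf_isFrobenioid π hF) ψ
          (BiratUnits.unitsToBirat (pf_isFrobenioid π hF) X
            (unitsPerfEquiv X (Frobenioids.Perfection.of _ (D0.unitPull (π.map (Base (pfStr π hF) ψ)) w))))
          (BiratUnits.unitsToBirat (pf_isFrobenioid π hF) X'
            (unitsPerfEquiv X' (Frobenioids.Perfection.of _ w))) := by
  intro X X' ψ _ w
  have hR : (π.obj X'.obj.snd) = D0.real := hreal X'.obj
  have h2 : ((w : ℂˣ)) ^ 2 = 1 := by
    have hm : (w : ℂˣ) ∈ D0.scalars D0.real :=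
      (congrArg (fun K : D0 => (w : ℂˣ) ∈ D0.scalars K) hR).mp w.2.1
    exact sq_eq_one_of_mem_scalars_real hm w.2.2
  have e1 : Frobenioids.Perfection.of (D0.unitScalars (π.obj X'.obj.snd)) w = 1 :=
    perfection_of_eq_one_of_sq _ h2
  have e2 : Frobenioids.Perfection.of (D0.unitScalars (π.obj X.obj.snd))
      (D0.unitPull (π.map (Base (pfStr π hF) ψ)) w) = 1 :=
    perfection_of_eq_one_of_sq _ (by rw [D0.coe_unitPull, ← map_pow, h2, map_one])
  have u1 : unitsPerfEquiv X' (Frobenioids.Perfection.of (D0.unitScalars (π.obj X'.obj.snd)) w) = 1 := by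
    rw [e1]; exact (unitsPerfEquiv X').map_one
  have u2 : unitsPerfEquiv X (Frobenioids.Perfection.of (D0.unitScalars (π.obj X.obj.snd))
      (D0.unitPull (π.map (Base (pfStr π hF) ψ)) w)) = 1 := by
    rw [e2]; exact (unitsPerfEquiv X).map_one
  rw [u1, u2, map_one, map_one]
  exact BiratUnits.Intertwines.one (PreFrobenioid.hasBiratSquares_of_isFrobenioid (pf_isFrobenioid π hF)) ψ

/-- **Characterisation**: the exponent-free unit-transport law (`hunit` of `Thm36Sub.istrModel_Q_of_section`)
holds for THE perfection of `C → F_Φ` over `π : D ⥤ D₀` **iff no object of `C` is complex**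
(`not_unitTransportLaw_of_isComplex` + `unitTransportLaw_of_forall_isReal`). [cite: MochizukiFrdII2008, Thm 3.6 (v) p.37] -/
theorem unitTransportLaw_iff_forall_isReal :
    (∀ ⦃X X' : pfCat π hF⦄ (ψ : X ⟶ X'), IsLinear (pfStr π hF) ψ →
      ∀ w : D0.unitScalars (π.obj X'.obj.snd),
        BiratUnits.Intertwines (pf_isFrobenioid π hF) ψ
          (BiratUnits.unitsToBirat (pf_isFrobenioid π hF) X
            (unitsPerfEquiv X (Frobenioids.Perfection.of _ (D0.unitPull (π.map (Base (pfStr π hF) ψ)) w))))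
          (BiratUnits.unitsToBirat (pf_isFrobenioid π hF) X'
            (unitsPerfEquiv X' (Frobenioids.Perfection.of _ w)))) ↔
      ∀ A : C π, (π.obj A.snd).IsReal := by
  refine ⟨fun h A => ?_, unitTransportLaw_of_forall_isReal hF⟩
  rcases D0.isReal_or_isComplex (π.obj A.snd) with hR | hC
  · exact hR
  · exact absurd h (not_unitTransportLaw_of_isComplex hF A hC)

end Thm36Sub

end ArchFrd

end Literature.AlgebraicGeometry.Frobenioids

end
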